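import Summits.AnomalousDissipation.AnomalousDissipation.Theorems.SawtoothPulseCascadeK1LocalisedCascadeCanonicalBlocks
import Summits.AnomalousDissipation.AnomalousDissipation.Theorems.SawtoothPulseCascadeK1LocalisedCascadeCanonicalBlocksMax
import Summits.AnomalousDissipation.AnomalousDissipation.Theorems.SawtoothPulseCascadeK1LocalisedCascadeBlockKernelLog

/-!
# K1loc, line `Spectral` / thin start — helper: CANONICAL GEOMETRIC BLOCKS, SHARP (log) BLOCK CONSTANTS

Helper file of the prover lane on the crux `K1LocalisedCascade` (stmt-AnomalousDissipation-19491), route `SawtoothPulseCascade`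
(S-B/S-C assembly seat; the LEDGER ASSEMBLY, arithmetic layer, Log2 grade).  `…CanonicalBlocks` bounds the PLAIN block constants
(`A_m ≤ A*`, `τ_m ≤ τ₀/2^m`) on the blocks `Λ_m = Λ₀2^m`, `Q₂^m = ⌊q_nΛ_m/q_d⌋`; this file does the same for the SHARP constants of
`…RatioBlocksLog2` / `…StripBlocksLog2`:
* `canon_ratio_den_ge` — `((uG−v)q_d − uq_n)Λ₀·2^m/(uq_d) ≤ ((uG−v)Λ_m − uQ₂^m)/u` (the block denominator grows geometrically);
* `canon_ratio_Alog_le` — `A^log_m ≤ 4/π + (2/π)log A* + uq_d/(((uG−v)q_d − uq_n)Λ₀) + (uq_d)²/(π(((uG−v)q_d − uq_n)Λ₀)²)` and `0 < A^log_m`;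
* `canon_ratio_tauLog_le` — `u/(2((uG−v)Λ_m − uQ₂^m)) ≤ (uq_d/(2((uG−v)q_d − uq_n)Λ₀))/2^m` and `0 ≤ ·`;
* `canon_strip_den_ge`, `canon_strip_Alog_le`, `canon_strip_tauLog_le` — the strip-window twins (`((Gq_d − q_n)Λ₀ − Kq_d)·2^m/q_d ≤ Λ_mG − K − Q₂^m`);
* `logCutoff_le` — the log cut-off ratio `4/π + (2/π)log r_m + 1/(Q₂−Q₁) + 1/(π(Q₂−Q₁)²) ≤ 4/π + (2/π)log r* + 1 + 1/π` from `r_m ≤ r*`, `Q₁ < Q₂`.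
Pure arithmetic; no definitions; no statement about the crux. [cite: Grafakos2014, §3.1.3] [problem: turb]
-/

-- `Summit.<Summit>.<Problem>`: single-conjunct summit, the duplicate namespace segment is deliberate.
set_option linter.dupNamespace false

noncomputable section

namespace Summit.AnomalousDissipation.AnomalousDissipation.Theorems.SawtoothPulseCascade.K1Window

/-! ## §1 The log cut-off ratio -/

/-- **The log cut-off ratio of a block**: `Q₁ < Q₂` (naturals) and `(Q₁+Q₂)/(Q₂−Q₁) ≤ r*` give
`4/π + (2/π)log((Q₁+Q₂)/(Q₂−Q₁)) + 1/(Q₂−Q₁) + 1/(π(Q₂−Q₁)²) ≤ 4/π + (2/π)log r* + 1 + 1/π`. [folklore] -/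
theorem logCutoff_le {Q₁ Q₂ : ℕ} {rs : ℝ} (hQ : Q₁ < Q₂) (hr : (((Q₁ : ℕ) : ℝ) + Q₂) / ((Q₂ : ℝ) - Q₁) ≤ rs) :
    4 / Real.pi + 2 / Real.pi * Real.log ((((Q₁ : ℕ) : ℝ) + Q₂) / ((Q₂ : ℝ) - Q₁)) + 1 / ((Q₂ : ℝ) - Q₁) +
        1 / (Real.pi * ((Q₂ : ℝ) - Q₁) ^ 2) ≤
      4 / Real.pi + 2 / Real.pi * Real.log rs + 1 + 1 / Real.pi := by
  have hQ' : (Q₁ : ℝ) + 1 ≤ Q₂ := by exact_mod_cast hQ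
  have hx : 0 < (((Q₁ : ℕ) : ℝ) + Q₂) / ((Q₂ : ℝ) - Q₁) := by
    refine div_pos ?_ (by linarith)
    have : (0 : ℝ) ≤ Q₁ := by positivity
    linarith
  have h := logKernel_mono hx hr one_pos (by linarith : (1 : ℝ) ≤ (Q₂ : ℝ) - Q₁)
  simpa using h

/-! ## §2 The ratio window -/

/-- **The block denominator grows geometrically (ratio window)**: `((uG−v)q_d − uq_n)Λ₀2^m/(uq_d) ≤ ((uG−v)Λ_m − uQ₂^m)/u`.
[folklore] -/
theorem canon_ratio_den_ge {u v G qn qd Λ0 : ℕ} (hu : 0 < u) (hqd : 0 < qd) (m : ℕ) :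
    (((u : ℝ) * G - v) * qd - u * qn) * Λ0 * 2 ^ m / (u * qd) ≤
      (((u : ℝ) * G - v) * ((Λ0 * 2 ^ m : ℕ) : ℝ) - u * ((qn * (Λ0 * 2 ^ m) / qd : ℕ) : ℝ)) / u := by
  have hur : (0 : ℝ) < u := by exact_mod_cast hu
  have hqdr : (0 : ℝ) < qd := by exact_mod_cast hqd
  set Λ : ℕ := Λ0 * 2 ^ m with hΛdef
  have hΛcast : ((Λ : ℕ) : ℝ) = (Λ0 : ℝ) * 2 ^ m := by rw [hΛdef]; push_cast; ring
  have hQle : ((qn * Λ / qd : ℕ) : ℝ) ≤ (qn : ℝ) / qd * Λ := canon_Q₂_le qn qd Λ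
  rw [div_le_div_iff₀ (by positivity) hur]
  have h1 : (u : ℝ) * ((qn * Λ / qd : ℕ) : ℝ) * qd ≤ u * qn * (Λ : ℝ) := by
    have := mul_le_mul_of_nonneg_left hQle (by positivity : (0 : ℝ) ≤ u * qd)
    have e : (u : ℝ) * qd * ((qn : ℝ) / qd * Λ) = u * qn * Λ := by field_simp
    nlinarith
  rw [hΛcast] at h1 ⊢
  nlinarith [hur, hqdr]

/-- **The sharp trapezoid constant on canonical blocks (ratio window)**: `A^log_m ≤ A^log*` (see the file header) and `0 < A^log_m`.
[folklore] -/
theorem canon_ratio_Alog_le {u v G qn qd Λ0 : ℕ} (hu : 0 < u) (hqd : 0 < qd) (hvu : v < u * G) (hq : u * qn < qd * (u * G - v))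
    (hΛ0 : 1 ≤ Λ0) (m : ℕ) :
    0 < 4 / Real.pi + 2 / Real.pi * Real.log ((((v : ℝ) + u * G) * ((Λ0 * 2 ^ m : ℕ) : ℝ) + u * ((qn * (Λ0 * 2 ^ m) / qd : ℕ) : ℝ)) /
          (((u : ℝ) * G - v) * ((Λ0 * 2 ^ m : ℕ) : ℝ) - u * ((qn * (Λ0 * 2 ^ m) / qd : ℕ) : ℝ))) +
        1 / ((((u : ℝ) * G - v) * ((Λ0 * 2 ^ m : ℕ) : ℝ) - u * ((qn * (Λ0 * 2 ^ m) / qd : ℕ) : ℝ)) / u) +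
        1 / (Real.pi * ((((u : ℝ) * G - v) * ((Λ0 * 2 ^ m : ℕ) : ℝ) - u * ((qn * (Λ0 * 2 ^ m) / qd : ℕ) : ℝ)) / u) ^ 2) ∧
    4 / Real.pi + 2 / Real.pi * Real.log ((((v : ℝ) + u * G) * ((Λ0 * 2 ^ m : ℕ) : ℝ) + u * ((qn * (Λ0 * 2 ^ m) / qd : ℕ) : ℝ)) /
          (((u : ℝ) * G - v) * ((Λ0 * 2 ^ m : ℕ) : ℝ) - u * ((qn * (Λ0 * 2 ^ m) / qd : ℕ) : ℝ))) +
        1 / ((((u : ℝ) * G - v) * ((Λ0 * 2 ^ m : ℕ) : ℝ) - u * ((qn * (Λ0 * 2 ^ m) / qd : ℕ) : ℝ)) / u) +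
        1 / (Real.pi * ((((u : ℝ) * G - v) * ((Λ0 * 2 ^ m : ℕ) : ℝ) - u * ((qn * (Λ0 * 2 ^ m) / qd : ℕ) : ℝ)) / u) ^ 2) ≤
      4 / Real.pi + 2 / Real.pi * Real.log ((((v : ℝ) + u * G) * qd + u * qn) / (((u : ℝ) * G - v) * qd - u * qn)) +
        1 / ((((u : ℝ) * G - v) * qd - u * qn) * Λ0 / (u * qd)) +
        1 / (Real.pi * ((((u : ℝ) * G - v) * qd - u * qn) * Λ0 / (u * qd)) ^ 2) := by
  have hur : (0 : ℝ) < u := by exact_mod_cast hu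
  have hqdr : (0 : ℝ) < qd := by exact_mod_cast hqd
  have hΛge : 1 ≤ Λ0 * 2 ^ m := hΛ0.trans (canon_blocks_ge Λ0 m)
  obtain ⟨hApos, hAle⟩ := canon_ratio_A_le (G := G) (v := v) hqd hvu hq hΛge
  have hqr : (u : ℝ) * qn < qd * ((u : ℝ) * G - v) := by
    have h : ((u * qn : ℕ) : ℝ) < ((qd * (u * G - v) : ℕ) : ℝ) := by exact_mod_cast hq
    rw [Nat.cast_mul, Nat.cast_mul, Nat.cast_sub hvu.le, Nat.cast_mul] at h
    exact h
  have hD0 : 0 < (((u : ℝ) * G - v) * qd - u * qn) * Λ0 / (u * qd) := by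
    have : (1 : ℝ) ≤ Λ0 := by exact_mod_cast hΛ0
    have h1 : 0 < ((u : ℝ) * G - v) * qd - u * qn := by linarith
    positivity
  have hden := canon_ratio_den_ge (G := G) (v := v) (qn := qn) (Λ0 := Λ0) hu hqd m
  have hden' : (((u : ℝ) * G - v) * qd - u * qn) * Λ0 / (u * qd) ≤
      (((u : ℝ) * G - v) * ((Λ0 * 2 ^ m : ℕ) : ℝ) - u * ((qn * (Λ0 * 2 ^ m) / qd : ℕ) : ℝ)) / u := by
    refine le_trans ?_ hden
    have h2m : (1 : ℝ) ≤ 2 ^ m := one_le_pow₀ (by norm_num)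
    have h0 : 0 ≤ (((u : ℝ) * G - v) * qd - u * qn) * Λ0 / (u * qd) := hD0.le
    calc (((u : ℝ) * G - v) * qd - u * qn) * Λ0 / (u * qd) = (((u : ℝ) * G - v) * qd - u * qn) * Λ0 / (u * qd) * 1 := by ring
      _ ≤ (((u : ℝ) * G - v) * qd - u * qn) * Λ0 / (u * qd) * 2 ^ m := mul_le_mul_of_nonneg_left h2m h0
      _ = (((u : ℝ) * G - v) * qd - u * qn) * Λ0 * 2 ^ m / (u * qd) := by ring
  have hDm : 0 < (((u : ℝ) * G - v) * ((Λ0 * 2 ^ m : ℕ) : ℝ) - u * ((qn * (Λ0 * 2 ^ m) / qd : ℕ) : ℝ)) / u :=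
    lt_of_lt_of_le hD0 hden'
  refine ⟨?_, logKernel_mono hApos hAle hD0 hden'⟩
  have hlog : 0 ≤ Real.log ((((v : ℝ) + u * G) * ((Λ0 * 2 ^ m : ℕ) : ℝ) + u * ((qn * (Λ0 * 2 ^ m) / qd : ℕ) : ℝ)) /
      (((u : ℝ) * G - v) * ((Λ0 * 2 ^ m : ℕ) : ℝ) - u * ((qn * (Λ0 * 2 ^ m) / qd : ℕ) : ℝ))) := by
    refine Real.log_nonneg ?_
    have hd : 0 < ((u : ℝ) * G - v) * ((Λ0 * 2 ^ m : ℕ) : ℝ) - u * ((qn * (Λ0 * 2 ^ m) / qd : ℕ) : ℝ) := by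
      have := mul_pos hDm hur
      rwa [div_mul_cancel₀ _ hur.ne'] at this
    rw [le_div_iff₀ hd]
    have : (0 : ℝ) ≤ (v : ℝ) * ((Λ0 * 2 ^ m : ℕ) : ℝ) := by positivity
    have : (0 : ℝ) ≤ (u : ℝ) * ((qn * (Λ0 * 2 ^ m) / qd : ℕ) : ℝ) := by positivity
    linarith
  positivity

/-- **The sharp kernel layer on canonical blocks (ratio window)**: `u/(2((uG−v)Λ_m − uQ₂^m)) ≤ (uq_d/(2((uG−v)q_d − uq_n)Λ₀))/2^m`
and it is non-negative. [folklore] -/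
theorem canon_ratio_tauLog_le {u v G qn qd Λ0 : ℕ} (hu : 0 < u) (hqd : 0 < qd) (hvu : v < u * G) (hq : u * qn < qd * (u * G - v))
    (hΛ0 : 1 ≤ Λ0) (m : ℕ) :
    0 ≤ (u : ℝ) / (2 * (((u : ℝ) * G - v) * ((Λ0 * 2 ^ m : ℕ) : ℝ) - u * ((qn * (Λ0 * 2 ^ m) / qd : ℕ) : ℝ))) ∧
    (u : ℝ) / (2 * (((u : ℝ) * G - v) * ((Λ0 * 2 ^ m : ℕ) : ℝ) - u * ((qn * (Λ0 * 2 ^ m) / qd : ℕ) : ℝ))) ≤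
      (u : ℝ) * qd / (2 * ((((u : ℝ) * G - v) * qd - u * qn) * Λ0)) / 2 ^ m := by
  have hur : (0 : ℝ) < u := by exact_mod_cast hu
  have hqdr : (0 : ℝ) < qd := by exact_mod_cast hqd
  have hΛge : 1 ≤ Λ0 * 2 ^ m := hΛ0.trans (canon_blocks_ge Λ0 m)
  have hdenpos := canon_ratio_den_pos (G := G) (qn := qn) (qd := qd) hvu hq hΛge
  have hqr : (u : ℝ) * qn < qd * ((u : ℝ) * G - v) := by
    have h : ((u * qn : ℕ) : ℝ) < ((qd * (u * G - v) : ℕ) : ℝ) := by exact_mod_cast hq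
    rw [Nat.cast_mul, Nat.cast_mul, Nat.cast_sub hvu.le, Nat.cast_mul] at h
    exact h
  have h1 : 0 < ((u : ℝ) * G - v) * qd - u * qn := by linarith
  have hΛ0r : (1 : ℝ) ≤ Λ0 := by exact_mod_cast hΛ0
  have hden := canon_ratio_den_ge (G := G) (v := v) (qn := qn) (Λ0 := Λ0) hu hqd m
  -- multiply the denominator comparison by `u`
  have hden2 : (((u : ℝ) * G - v) * qd - u * qn) * Λ0 * 2 ^ m / qd ≤
      ((u : ℝ) * G - v) * ((Λ0 * 2 ^ m : ℕ) : ℝ) - u * ((qn * (Λ0 * 2 ^ m) / qd : ℕ) : ℝ) := by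
    have := mul_le_mul_of_nonneg_right hden hur.le
    rw [div_mul_cancel₀ _ hur.ne'] at this
    refine le_trans (le_of_eq ?_) this
    field_simp
  have hpos' : 0 < (((u : ℝ) * G - v) * qd - u * qn) * Λ0 * 2 ^ m / qd := by positivity
  refine ⟨div_nonneg hur.le (by linarith), ?_⟩
  calc (u : ℝ) / (2 * (((u : ℝ) * G - v) * ((Λ0 * 2 ^ m : ℕ) : ℝ) - u * ((qn * (Λ0 * 2 ^ m) / qd : ℕ) : ℝ)))
      ≤ (u : ℝ) / (2 * ((((u : ℝ) * G - v) * qd - u * qn) * Λ0 * 2 ^ m / qd)) :=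
        div_le_div_of_nonneg_left hur.le (by positivity) (by linarith)
    _ = (u : ℝ) * qd / (2 * ((((u : ℝ) * G - v) * qd - u * qn) * Λ0)) / 2 ^ m := by
        field_simp

/-! ## §3 The strip / low-fibre window -/

/-- **The block denominator grows geometrically (strip window)**: `((Gq_d − q_n)Λ₀ − Kq_d)·2^m/q_d ≤ Λ_mG − (K + Q₂^m)`. [folklore] -/
theorem canon_strip_den_ge {K G qn qd Λ0 : ℕ} (hqd : 0 < qd) (hK : K * qd + qn * Λ0 < G * qd * Λ0) (m : ℕ) :
    (((G : ℝ) * qd - qn) * Λ0 - K * qd) * 2 ^ m / qd ≤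
      (((Λ0 * 2 ^ m) * G : ℕ) : ℝ) - ((K + qn * (Λ0 * 2 ^ m) / qd : ℕ) : ℝ) := by
  have hqdr : (0 : ℝ) < qd := by exact_mod_cast hqd
  have hKr : (K : ℝ) * qd + qn * Λ0 < G * qd * Λ0 := by exact_mod_cast hK
  set Λ : ℕ := Λ0 * 2 ^ m with hΛdef
  have hΛcast : ((Λ : ℕ) : ℝ) = (Λ0 : ℝ) * 2 ^ m := by rw [hΛdef]; push_cast; ring
  have hQle : ((qn * Λ / qd : ℕ) : ℝ) ≤ (qn : ℝ) / qd * Λ := canon_Q₂_le qn qd Λ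
  have eKQ : ((K + qn * Λ / qd : ℕ) : ℝ) = (K : ℝ) + ((qn * Λ / qd : ℕ) : ℝ) := by push_cast; rfl
  have eΛG : ((Λ * G : ℕ) : ℝ) = (Λ : ℝ) * G := by push_cast; rfl
  rw [eKQ, eΛG, div_le_iff₀ hqdr, hΛcast]
  have h1 : ((qn * Λ / qd : ℕ) : ℝ) * qd ≤ qn * (Λ : ℝ) := by
    have := mul_le_mul_of_nonneg_right hQle hqdr.le
    have e : (qn : ℝ) / qd * Λ * qd = qn * Λ := by field_simp
    linarith
  rw [hΛcast] at h1
  have h2m : (1 : ℝ) ≤ 2 ^ m := one_le_pow₀ (by norm_num)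
  have h3 : (K : ℝ) * qd ≤ K * qd * 2 ^ m := le_mul_of_one_le_right (by positivity) h2m
  nlinarith

/-- **The sharp trapezoid constant on canonical blocks (strip window)**: `A^log_m ≤ 4/π + (2/π)log A* + q_d/((Gq_d−q_n)Λ₀−Kq_d) +
q_d²/(π((Gq_d−q_n)Λ₀−Kq_d)²)` with `A* = (Kq_d + (q_n+Gq_d)Λ₀)/((Gq_d−q_n)Λ₀ − Kq_d)`, and `0 < A^log_m`. [folklore] -/
theorem canon_strip_Alog_le {K G qn qd Λ0 : ℕ} (hqd : 0 < qd) (hK : K * qd + qn * Λ0 < G * qd * Λ0) (m : ℕ) :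
    0 < 4 / Real.pi + 2 / Real.pi * Real.log ((((K + qn * (Λ0 * 2 ^ m) / qd : ℕ) : ℝ) + (((Λ0 * 2 ^ m) * G : ℕ) : ℝ)) /
          ((((Λ0 * 2 ^ m) * G : ℕ) : ℝ) - ((K + qn * (Λ0 * 2 ^ m) / qd : ℕ) : ℝ))) +
        1 / ((((Λ0 * 2 ^ m) * G : ℕ) : ℝ) - ((K + qn * (Λ0 * 2 ^ m) / qd : ℕ) : ℝ)) +
        1 / (Real.pi * ((((Λ0 * 2 ^ m) * G : ℕ) : ℝ) - ((K + qn * (Λ0 * 2 ^ m) / qd : ℕ) : ℝ)) ^ 2) ∧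
    4 / Real.pi + 2 / Real.pi * Real.log ((((K + qn * (Λ0 * 2 ^ m) / qd : ℕ) : ℝ) + (((Λ0 * 2 ^ m) * G : ℕ) : ℝ)) /
          ((((Λ0 * 2 ^ m) * G : ℕ) : ℝ) - ((K + qn * (Λ0 * 2 ^ m) / qd : ℕ) : ℝ))) +
        1 / ((((Λ0 * 2 ^ m) * G : ℕ) : ℝ) - ((K + qn * (Λ0 * 2 ^ m) / qd : ℕ) : ℝ)) +
        1 / (Real.pi * ((((Λ0 * 2 ^ m) * G : ℕ) : ℝ) - ((K + qn * (Λ0 * 2 ^ m) / qd : ℕ) : ℝ)) ^ 2) ≤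
      4 / Real.pi + 2 / Real.pi * Real.log (((K : ℝ) * qd + ((qn : ℝ) + G * qd) * Λ0) / (((G : ℝ) * qd - qn) * Λ0 - K * qd)) +
        1 / ((((G : ℝ) * qd - qn) * Λ0 - K * qd) / qd) + 1 / (Real.pi * ((((G : ℝ) * qd - qn) * Λ0 - K * qd) / qd) ^ 2) := by
  have hqdr : (0 : ℝ) < qd := by exact_mod_cast hqd
  have hKr : (K : ℝ) * qd + qn * Λ0 < G * qd * Λ0 := by exact_mod_cast hK
  obtain ⟨hApos, hAle⟩ := canon_strip_A_le (G := G) hqd hK (canon_blocks_ge Λ0 m)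
  have hD0 : 0 < (((G : ℝ) * qd - qn) * Λ0 - K * qd) / qd := by
    have h1 : 0 < ((G : ℝ) * qd - qn) * Λ0 - K * qd := by linarith
    positivity
  have hden := canon_strip_den_ge (G := G) hqd hK m
  have hden' : (((G : ℝ) * qd - qn) * Λ0 - K * qd) / qd ≤
      (((Λ0 * 2 ^ m) * G : ℕ) : ℝ) - ((K + qn * (Λ0 * 2 ^ m) / qd : ℕ) : ℝ) := by
    refine le_trans ?_ hden
    have h2m : (1 : ℝ) ≤ 2 ^ m := one_le_pow₀ (by norm_num)
    calc (((G : ℝ) * qd - qn) * Λ0 - K * qd) / qd = (((G : ℝ) * qd - qn) * Λ0 - K * qd) / qd * 1 := by ring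
      _ ≤ (((G : ℝ) * qd - qn) * Λ0 - K * qd) / qd * 2 ^ m := mul_le_mul_of_nonneg_left h2m hD0.le
      _ = (((G : ℝ) * qd - qn) * Λ0 - K * qd) * 2 ^ m / qd := by ring
  have hDm : 0 < (((Λ0 * 2 ^ m) * G : ℕ) : ℝ) - ((K + qn * (Λ0 * 2 ^ m) / qd : ℕ) : ℝ) := lt_of_lt_of_le hD0 hden'
  refine ⟨?_, logKernel_mono hApos hAle hD0 hden'⟩
  have hlog : 0 ≤ Real.log ((((K + qn * (Λ0 * 2 ^ m) / qd : ℕ) : ℝ) + (((Λ0 * 2 ^ m) * G : ℕ) : ℝ)) /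
      ((((Λ0 * 2 ^ m) * G : ℕ) : ℝ) - ((K + qn * (Λ0 * 2 ^ m) / qd : ℕ) : ℝ))) := by
    refine Real.log_nonneg ?_
    rw [le_div_iff₀ hDm]
    have : (0 : ℝ) ≤ ((K + qn * (Λ0 * 2 ^ m) / qd : ℕ) : ℝ) := by positivity
    linarith
  positivity

/-- **The sharp kernel layer on canonical blocks (strip window)**: `1/(2(Λ_mG − K − Q₂^m)) ≤ (q_d/(2((Gq_d−q_n)Λ₀ − Kq_d)))/2^m`
and it is non-negative. [folklore] -/
theorem canon_strip_tauLog_le {K G qn qd Λ0 : ℕ} (hqd : 0 < qd) (hK : K * qd + qn * Λ0 < G * qd * Λ0) (m : ℕ) :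
    0 ≤ 1 / (2 * ((((Λ0 * 2 ^ m) * G : ℕ) : ℝ) - ((K + qn * (Λ0 * 2 ^ m) / qd : ℕ) : ℝ))) ∧
    1 / (2 * ((((Λ0 * 2 ^ m) * G : ℕ) : ℝ) - ((K + qn * (Λ0 * 2 ^ m) / qd : ℕ) : ℝ))) ≤
      (qd : ℝ) / (2 * (((G : ℝ) * qd - qn) * Λ0 - K * qd)) / 2 ^ m := by
  have hqdr : (0 : ℝ) < qd := by exact_mod_cast hqd
  have hKr : (K : ℝ) * qd + qn * Λ0 < G * qd * Λ0 := by exact_mod_cast hK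
  have h1 : 0 < ((G : ℝ) * qd - qn) * Λ0 - K * qd := by linarith
  have hden := canon_strip_den_ge (G := G) hqd hK m
  have hpos' : 0 < (((G : ℝ) * qd - qn) * Λ0 - K * qd) * 2 ^ m / qd := by positivity
  have hDm : 0 < (((Λ0 * 2 ^ m) * G : ℕ) : ℝ) - ((K + qn * (Λ0 * 2 ^ m) / qd : ℕ) : ℝ) := lt_of_lt_of_le hpos' hden
  refine ⟨by positivity, ?_⟩
  calc 1 / (2 * ((((Λ0 * 2 ^ m) * G : ℕ) : ℝ) - ((K + qn * (Λ0 * 2 ^ m) / qd : ℕ) : ℝ)))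
      ≤ 1 / (2 * ((((G : ℝ) * qd - qn) * Λ0 - K * qd) * 2 ^ m / qd)) :=
        one_div_le_one_div_of_le (by positivity) (by linarith)
    _ = (qd : ℝ) / (2 * (((G : ℝ) * qd - qn) * Λ0 - K * qd)) / 2 ^ m := by
        field_simp

/-! ## §4 The cut-off gap of the `max` family -/

/-- **The log cut-off ratio of a block with an explicit gap**: `(Q₁+Q₂)/(Q₂−Q₁) ≤ r*` and `0 < D′ ≤ Q₂ − Q₁` give
`4/π + (2/π)log((Q₁+Q₂)/(Q₂−Q₁)) + 1/(Q₂−Q₁) + 1/(π(Q₂−Q₁)²) ≤ 4/π + (2/π)log r* + 1/D′ + 1/(πD′²)` (use with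
`D′ = (β − t)Λ₀ − 1` from the canonical separation; `logCutoff_le` is the case `D′ = 1`). [folklore] -/
theorem logCutoff_le_of_gap {Q₁ Q₂ : ℕ} {rs D' : ℝ} (hQ : Q₁ < Q₂) (hr : (((Q₁ : ℕ) : ℝ) + Q₂) / ((Q₂ : ℝ) - Q₁) ≤ rs)
    (hD' : 0 < D') (hD : D' ≤ (Q₂ : ℝ) - Q₁) :
    4 / Real.pi + 2 / Real.pi * Real.log ((((Q₁ : ℕ) : ℝ) + Q₂) / ((Q₂ : ℝ) - Q₁)) + 1 / ((Q₂ : ℝ) - Q₁) +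
        1 / (Real.pi * ((Q₂ : ℝ) - Q₁) ^ 2) ≤
      4 / Real.pi + 2 / Real.pi * Real.log rs + 1 / D' + 1 / (Real.pi * D' ^ 2) := by
  have hQ' : (Q₁ : ℝ) + 1 ≤ Q₂ := by exact_mod_cast hQ
  have hx : 0 < (((Q₁ : ℕ) : ℝ) + Q₂) / ((Q₂ : ℝ) - Q₁) := by
    refine div_pos ?_ (by linarith)
    have : (0 : ℝ) ≤ Q₁ := by positivity
    linarith
  exact logKernel_mono hx hr hD' hD

/-- **The canonical gap**: for the `max` family (`…CanonicalBlocksMax`: `Q₁^m ≤ tΛ_m`, separation `(β−t)Λ₀ ≥ 2`),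
`(β − t)Λ₀ − 1 ≤ Q₂^m − Q₁^m` on every block. [folklore] -/
theorem canonMax_gap_le {u' v' Y₀ tn td qn qd Λ0 : ℕ} (hv' : 0 < v') (htd : 0 < td) (hqd : 0 < qd)
    (h1 : 2 * u' * td ≤ tn * v') (h2 : Y₀ * td ≤ tn * Λ0) (h3 : tn * qd * Λ0 + 2 * qd * td ≤ qn * td * Λ0) (m : ℕ) :
    ((qn : ℝ) / qd - (tn : ℝ) / td) * Λ0 - 1 ≤
      ((qn * (Λ0 * 2 ^ m) / qd : ℕ) : ℝ) - ((max (2 * u' * (Λ0 * 2 ^ m) / v') Y₀ : ℕ) : ℝ) := by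
  have hqdr : (0 : ℝ) < qd := by exact_mod_cast hqd
  have htdr : (0 : ℝ) < td := by exact_mod_cast htd
  have hQ1 := canonMax_Q₁_le hv' htd h1 h2 (canon_blocks_ge Λ0 m) (u' := u')
  have hQ2 : (qn : ℝ) / qd * ((Λ0 * 2 ^ m : ℕ) : ℝ) - 1 ≤ ((qn * (Λ0 * 2 ^ m) / qd : ℕ) : ℝ) := by
    have h := Nat.lt_div_mul_add (a := qn * (Λ0 * 2 ^ m)) hqd
    have h' : ((qn * (Λ0 * 2 ^ m) : ℕ) : ℝ) < ((qn * (Λ0 * 2 ^ m) / qd * qd + qd : ℕ) : ℝ) := by exact_mod_cast h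
    push_cast at h'
    rw [div_mul_eq_mul_div, sub_le_iff_le_add, div_le_iff₀ hqdr]
    push_cast
    nlinarith
  have hΛ : (Λ0 : ℝ) ≤ ((Λ0 * 2 ^ m : ℕ) : ℝ) := by exact_mod_cast canon_blocks_ge Λ0 m
  have h3r : (tn : ℝ) * qd * Λ0 + 2 * qd * td ≤ qn * td * Λ0 := by exact_mod_cast h3
  have hβt : 0 ≤ (qn : ℝ) / qd - (tn : ℝ) / td := by
    rw [sub_nonneg, div_le_div_iff₀ htdr hqdr]
    have : (0 : ℝ) ≤ Λ0 := by positivity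
    rcases Nat.eq_zero_or_pos Λ0 with h | h
    · subst h; simp at h3; nlinarith [h3r]
    · have hΛ0 : (1 : ℝ) ≤ Λ0 := by exact_mod_cast h
      nlinarith
  nlinarith [mul_le_mul_of_nonneg_left hΛ hβt]

end Summit.AnomalousDissipation.AnomalousDissipation.Theorems.SawtoothPulseCascade.K1Window
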